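import Literature.Analysis.SpecialFunctions.KummerM
import Mathlib.Analysis.SpecialFunctions.Pow.Deriv
import Mathlib.Analysis.Complex.Convex
import HarnessLib

/-!
# The Whittaker function `M_{κ,μ}`: Whittaker's equation, the leading behaviour `z^{½+μ}` at the
# origin, the Frobenius pair `M_{κ,±μ}` and its Wronskian `−2μ`

Over Kummer's entire function `M(a, b, z) = ₁F₁(a; b; z)` (`KummerM.lean`: `kummerM`, its
derivative formula DLMF 13.3.15 and Kummer's equation DLMF 13.2.1) this file defines
**Whittaker's function**

  `whittakerM κ μ z = M_{κ,μ}(z) := e^{−z/2} z^{½+μ} M(½ + μ − κ, 1 + 2μ, z)`   (DLMF 13.14.2)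

(principal branch of `z^{½+μ}`: the standard `M_{κ,μ}` on `Complex.slitPlane = ℂ ∖ (−∞, 0]`) and
proves:

* `hasDerivAt_whittakerM`, `differentiableOn_whittakerM`, `analyticOnNhd_whittakerM` — calculus on
  the slit plane, with the explicit derivative;
* `whittakerM_ode_hasDerivAt`, `whittakerM_ode` — **WHITTAKER's EQUATION, DLMF 13.14.1**:
  `W″ + (−¼ + κ/z + (¼ − μ²)/z²) W = 0` on the slit plane, for `1 + 2μ ∉ −ℕ₀` (pointwise
  `HasDerivAt` packaging `W ↦ deriv W ↦ (¼ − κ/z − (¼ − μ²)/z²) W`, and the `deriv (deriv ·)`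
  form), by the gauge computation `W = z^c · F`, `F = e^{−z/2} M`, `c = ½ + μ`, `b = 2c`
  (`hasDerivAt_exp_neg_half_mul`, `hasDerivAt_cpow_mul`, `hasDerivAt_cpow_mul_deriv`,
  `frobenius_identity_of_kummer`: Kummer ⟹ `z²F″ + 2czF′ + c(c−1)F = (z²/4 + (a−c)z + c(c−1))F`);
* `tendsto_cpow_neg_mul_whittakerM` (`𝓝[≠] 0` in `ℂ`) and `…_ofReal` (`x → 0⁺`) — the **LEADING
  BEHAVIOUR** `z^{−(½+μ)} M_{κ,μ}(z) → 1`, DLMF 13.14.14 (off the origin `z^{−(½+μ)} M_{κ,μ}(z)`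
  IS the entire function `e^{−z/2} M(a,b,z)`, `cpow_neg_mul_whittakerM`);
* `whittakerM_pair_ode_hasDerivAt` — for `1 ± 2μ ∉ −ℕ₀` (e.g. `2μ ∉ ℤ`) BOTH `M_{κ,±μ}` solve the
  equation (the Frobenius basis `~ z^{½±μ}` at `0`); the instance `whittakerM_pair_T1w`
  (`κ = im`, `μ = iδ`, `δ ≠ 0`: the far face of the extremal Kerr threshold problem,
  `Literature/Geometry/Lorentzian/ExtremalKerrThresholdCoulomb.lean`);
* `hasDerivAt_wronskian_whittakerM` (Abel: derivative `0`), `wronskian_whittakerM_eq` (constancy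
  on the slit plane), `wronskian_whittakerM_eq_regular` (the Wronskian multiplied out: an ENTIRE
  expression `−2μ F₊F₋ + z(F₊F₋′ − F₊′F₋)`) and **`wronskian_whittakerM`:
  `𝒲{M_{κ,μ}, M_{κ,−μ}} = −2μ`** (DLMF 13.14.25; Beals–Wong (8.7.4)), the constant being read
  off as `x → 0⁺` in the entire expression; `wronskian_whittakerM_T1w` is the instance `−2iδ`.

Not treated here: `W_{κ,μ}` (Tricomi's `U`), the asymptotics DLMF 13.14.20–21, DLMF 13.14.33.

References: NIST DLMF §13.14, (13.14.1), (13.14.2), (13.14.14), (13.14.25) [DLMF]; R. Beals,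
R. Wong, *Special Functions and Orthogonal Polynomials* (2016), §8.7, (8.7.1), (8.7.2), (8.7.4)
[BealsWong2016].
-/

noncomputable section

open Filter Metric Complex
open scoped Topology

namespace Literature.Analysis.SpecialFunctions.Confluent

/-! ### Two calculus layers: the factor `e^{-z/2}` and the Frobenius factor `z^c` -/

section Layers

/-- Product rule with the factor `e^{-z/2}`: if `f' = f₁` at `z` then
`(e^{-w/2} f(w))' = e^{-z/2} (f₁ − f/2)` at `z`. [folklore] -/
theorem hasDerivAt_exp_neg_half_mul {z f' : ℂ} {f : ℂ → ℂ} (hf : HasDerivAt f f' z) :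
    HasDerivAt (fun w => exp (-w / 2) * f w) (exp (-z / 2) * (f' - f z / 2)) z := by
  have he : HasDerivAt (fun w : ℂ => exp (-w / 2)) (exp (-z / 2) * (-1 / 2)) z :=
    ((hasDerivAt_neg' z).div_const 2).cexp
  exact (he.mul hf).congr_deriv (by ring)

/-- Product rule with the Frobenius factor `z^c` (principal branch) on the slit plane: if
`F' = F₁ z` at `z` then `(w^c F(w))' = c z^{c−1} F(z) + z^c F₁(z)`. [folklore] -/
theorem hasDerivAt_cpow_mul {c z F' : ℂ} {F : ℂ → ℂ} (hz : z ∈ slitPlane)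
    (hF : HasDerivAt F F' z) :
    HasDerivAt (fun w => w ^ c * F w) (c * z ^ (c - 1) * F z + z ^ c * F') z :=
  (Complex.hasStrictDerivAt_cpow_const hz).hasDerivAt.mul hF

/-- **The Frobenius layer of a second-order equation.** If at `z ∈ slitPlane` we have `F' = F₁ z`,
`F₁' = F₂` and `z² F₂ + 2cz F₁ + c(c−1) F = z² q F`, then the function
`w ↦ c w^{c−1} F + w^c F₁` (the derivative of `w^c F`, `hasDerivAt_cpow_mul`) has derivative
`q · (z^c F)` at `z`: `(z^c F)'' = q · z^c F`. [folklore] -/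
theorem hasDerivAt_cpow_mul_deriv {c q z F₂ : ℂ} {F F₁ : ℂ → ℂ} (hz : z ∈ slitPlane)
    (hF : HasDerivAt F (F₁ z) z) (hF₁ : HasDerivAt F₁ F₂ z)
    (hq : z ^ 2 * F₂ + 2 * c * z * F₁ z + c * (c - 1) * F z = z ^ 2 * q * F z) :
    HasDerivAt (fun w => c * w ^ (c - 1) * F w + w ^ c * F₁ w) (q * (z ^ c * F z)) z := by
  have hz0 : z ≠ 0 := slitPlane_ne_zero hz
  have hd := (((Complex.hasStrictDerivAt_cpow_const (c := c - 1) hz).hasDerivAt.const_mul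
    c).mul hF).add ((Complex.hasStrictDerivAt_cpow_const (c := c) hz).hasDerivAt.mul hF₁)
  refine hd.congr_deriv ?_
  have h1 : z ^ (c - 1) = z ^ c / z := by rw [cpow_sub _ _ hz0, cpow_one]
  have h2 : z ^ (c - 1 - 1) = z ^ c / z / z := by rw [cpow_sub _ _ hz0, cpow_one, h1]
  rw [h1, h2]
  field_simp
  linear_combination z ^ c * hq

/-- **From Kummer's equation to Whittaker's normal form, at the level of the regular part.** If
`f' = f₁ z`, `f₁' = f₂` at `z` and `z f₂ + (b − z) f₁ − a f = 0` (Kummer's equation at `z`) with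
`b = 2c`, then `F = e^{-w/2} f` satisfies, with `F₁ = e^{-w/2}(f₁ − f/2)` and
`F₂ = e^{-z/2}(f₂ − f₁ + f/4)` (its first two derivatives, `hasDerivAt_exp_neg_half_mul`),
`z² F₂ + 2cz F₁ + c(c−1) F = (z²/4 + (a − c) z + c(c−1)) F`. [cite: DLMF, 13.14.1] -/
theorem frobenius_identity_of_kummer {a b c z f₂ : ℂ} {f f₁ : ℂ → ℂ} (hbc : b = 2 * c)
    (hz : z ≠ 0) (hode : z * f₂ + (b - z) * f₁ z - a * f z = 0) :
    z ^ 2 * (exp (-z / 2) * (f₂ - f₁ z + f z / 4)) +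
        2 * c * z * (exp (-z / 2) * (f₁ z - f z / 2)) +
        c * (c - 1) * (exp (-z / 2) * f z) =
      z ^ 2 * (1 / 4 + (a - c) / z + c * (c - 1) / z ^ 2) * (exp (-z / 2) * f z) := by
  subst hbc
  have e : z ^ 2 * (1 / 4 + (a - c) / z + c * (c - 1) / z ^ 2) =
      z ^ 2 / 4 + (a - c) * z + c * (c - 1) := by
    field_simp
  rw [e]
  linear_combination z * exp (-z / 2) * hode

end Layers

/-! ### The Whittaker function `M_{κ,μ}` -/

section WhittakerM

/-- **Whittaker's function** `M_{κ,μ}(z) = e^{−z/2} z^{½+μ} M(½ + μ − κ, 1 + 2μ, z)` (principal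
branch of `z^{½+μ}`, so this is the standard `M_{κ,μ}` on the slit plane `ℂ ∖ (−∞, 0]`; for
`2μ = −1, −2, …` the Kummer factor is Mathlib-style junk, cf. `kummerM`). [cite: DLMF, 13.14.2] -/
def whittakerM (κ μ z : ℂ) : ℂ :=
  exp (-z / 2) * z ^ (1 / 2 + μ : ℂ) * kummerM (1 / 2 + μ - κ) (1 + 2 * μ) z

variable (κ μ : ℂ)

/-- `M_{κ,μ}(z) = z^{½+μ} · (e^{−z/2} M(½+μ−κ, 1+2μ, z))` — Frobenius factor times an entire
"regular part". [cite: DLMF, 13.14.2] -/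
theorem whittakerM_eq_cpow_mul (z : ℂ) :
    whittakerM κ μ z =
      z ^ (1 / 2 + μ : ℂ) * (exp (-z / 2) * kummerM (1 / 2 + μ - κ) (1 + 2 * μ) z) := by
  simp only [whittakerM]; ring

/-- **The derivative of `M_{κ,μ}` on the slit plane**: with `a = ½+μ−κ`, `b = 1+2μ`,
`M_{κ,μ}'(z) = (½+μ) z^{μ−½} e^{−z/2} M(a,b,z) + z^{½+μ} e^{−z/2}((a/b) M(a+1,b+1,z) − M(a,b,z)/2)`.
[cite: DLMF, 13.14.2] -/
theorem hasDerivAt_whittakerM {z : ℂ} (hz : z ∈ slitPlane) :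
    HasDerivAt (whittakerM κ μ)
      ((1 / 2 + μ) * z ^ (μ - 1 / 2 : ℂ) * (exp (-z / 2) * kummerM (1 / 2 + μ - κ) (1 + 2 * μ) z) +
        z ^ (1 / 2 + μ : ℂ) * (exp (-z / 2) *
          ((1 / 2 + μ - κ) / (1 + 2 * μ) *
              kummerM (1 / 2 + μ - κ + 1) (1 + 2 * μ + 1) z -
            kummerM (1 / 2 + μ - κ) (1 + 2 * μ) z / 2))) z := by
  have hfun : whittakerM κ μ = fun w =>
      w ^ (1 / 2 + μ : ℂ) * (exp (-w / 2) * kummerM (1 / 2 + μ - κ) (1 + 2 * μ) w) :=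
    funext (whittakerM_eq_cpow_mul κ μ)
  rw [hfun]
  have h := hasDerivAt_cpow_mul (c := 1 / 2 + μ) hz
    (hasDerivAt_exp_neg_half_mul (hasDerivAt_kummerM (a := 1 / 2 + μ - κ) (b := 1 + 2 * μ) z))
  rwa [show (1 / 2 + μ - 1 : ℂ) = μ - 1 / 2 by ring] at h

/-- `M_{κ,μ}` is complex-differentiable on the slit plane. [cite: DLMF, 13.14(ii)] -/
theorem differentiableOn_whittakerM : DifferentiableOn ℂ (whittakerM κ μ) slitPlane :=
  fun _ hz => (hasDerivAt_whittakerM κ μ hz).differentiableAt.differentiableWithinAt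

/-- `M_{κ,μ}` is analytic on the slit plane. [cite: DLMF, 13.14(ii)] -/
theorem analyticOnNhd_whittakerM : AnalyticOnNhd ℂ (whittakerM κ μ) slitPlane :=
  (differentiableOn_whittakerM κ μ).analyticOnNhd isOpen_slitPlane

/-- **Whittaker's equation for `M_{κ,μ}`, DLMF 13.14.1, in pointwise `HasDerivAt` form** on the
slit plane, for `2μ ≠ −1, −2, …`: `M_{κ,μ}` has derivative `deriv M_{κ,μ} z` at `z`, and
`deriv M_{κ,μ}` has derivative `(¼ − κ/z − (¼ − μ²)/z²) · M_{κ,μ}(z)` at `z`, i.e.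
`W'' + (−¼ + κ/z + (¼ − μ²)/z²) W = 0`. [cite: DLMF, 13.14.1] -/
theorem whittakerM_ode_hasDerivAt (hμ : ∀ n : ℕ, 1 + 2 * μ ≠ -n) {z : ℂ} (hz : z ∈ slitPlane) :
    HasDerivAt (whittakerM κ μ) (deriv (whittakerM κ μ) z) z ∧
    HasDerivAt (deriv (whittakerM κ μ))
      ((1 / 4 - κ / z - (1 / 4 - μ ^ 2) / z ^ 2) * whittakerM κ μ z) z := by
  refine ⟨(hasDerivAt_whittakerM κ μ hz).differentiableAt.hasDerivAt, ?_⟩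
  -- names for the regular part and its derivatives
  set a : ℂ := 1 / 2 + μ - κ with ha
  set b : ℂ := 1 + 2 * μ with hb
  set c : ℂ := 1 / 2 + μ with hc
  obtain ⟨hM, hM₁, hode⟩ := kummerM_ode_hasDerivAt (a := a) hμ z
  set F : ℂ → ℂ := fun w => exp (-w / 2) * kummerM a b w with hF
  set F₁ : ℂ → ℂ := fun w => exp (-w / 2) * (a / b * kummerM (a + 1) (b + 1) w - kummerM a b w / 2)
    with hF₁
  have hdF : ∀ w, HasDerivAt F (F₁ w) w := fun w =>
    hasDerivAt_exp_neg_half_mul (hasDerivAt_kummerM w)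
  have hdF₁ : HasDerivAt F₁ (exp (-z / 2) * (a / b * ((a + 1) / (b + 1) *
      kummerM (a + 2) (b + 2) z) - (a / b * kummerM (a + 1) (b + 1) z) + kummerM a b z / 4)) z :=
    (hasDerivAt_exp_neg_half_mul (hM₁.sub (hM.div_const 2))).congr_deriv
      (by simp only [Pi.sub_apply]; ring)
  have hbc : b = 2 * c := by rw [hb, hc]; ring
  have hq := frobenius_identity_of_kummer (c := c) (f := kummerM a b)
    (f₁ := fun w => a / b * kummerM (a + 1) (b + 1) w) hbc (slitPlane_ne_zero hz) hode
  have key := hasDerivAt_cpow_mul_deriv (F₁ := F₁) hz (hdF z) hdF₁ hq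
  -- `deriv (whittakerM κ μ)` agrees with `w ↦ c w^{c-1} F + w^c F₁` near `z` (on the slit plane)
  have hW : whittakerM κ μ = fun w => w ^ c * F w := funext (whittakerM_eq_cpow_mul κ μ)
  have hderiv : deriv (whittakerM κ μ) =ᶠ[𝓝 z] fun w => c * w ^ (c - 1) * F w + w ^ c * F₁ w := by
    filter_upwards [isOpen_slitPlane.mem_nhds hz] with w hw
    rw [hW]
    exact (hasDerivAt_cpow_mul hw (hdF w)).deriv
  refine (key.congr_of_eventuallyEq hderiv).congr_deriv ?_
  rw [hW, ha, hc]
  field_simp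
  ring

/-- **Whittaker's equation, DLMF 13.14.1**, for `W = M_{κ,μ}` on the slit plane (`2μ ≠ −1, −2, …`):
`W'' + (−¼ + κ/z + (¼ − μ²)/z²) W = 0`, with `W'' = deriv (deriv W)`. [cite: DLMF, 13.14.1] -/
theorem whittakerM_ode (hμ : ∀ n : ℕ, 1 + 2 * μ ≠ -n) {z : ℂ} (hz : z ∈ slitPlane) :
    deriv (deriv (whittakerM κ μ)) z +
      (-1 / 4 + κ / z + (1 / 4 - μ ^ 2) / z ^ 2) * whittakerM κ μ z = 0 := by
  rw [(whittakerM_ode_hasDerivAt κ μ hμ hz).2.deriv]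
  ring

/-! ### Leading behaviour at `z = 0` -/

/-- Off the origin, `z^{−(½+μ)} M_{κ,μ}(z) = e^{−z/2} M(½+μ−κ, 1+2μ, z)` (an entire function with
value `1` at `0`). [cite: DLMF, 13.14.14] -/
theorem cpow_neg_mul_whittakerM {z : ℂ} (hz : z ≠ 0) :
    z ^ (-(1 / 2 + μ) : ℂ) * whittakerM κ μ z =
      exp (-z / 2) * kummerM (1 / 2 + μ - κ) (1 + 2 * μ) z := by
  rw [whittakerM_eq_cpow_mul, ← mul_assoc, ← cpow_add _ _ hz, neg_add_cancel, cpow_zero, one_mul]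

/-- **Leading behaviour of `M_{κ,μ}` at the origin** (all directions in the punctured plane):
`z^{−(½+μ)} M_{κ,μ}(z) → 1` as `z → 0`, `z ≠ 0`, i.e. `M_{κ,μ}(z) ∼ z^{½+μ}`.
[cite: DLMF, 13.14.14] -/
theorem tendsto_cpow_neg_mul_whittakerM :
    Tendsto (fun z : ℂ => z ^ (-(1 / 2 + μ) : ℂ) * whittakerM κ μ z) (𝓝[≠] 0) (𝓝 1) := by
  have hcont := (((continuous_neg.div_const 2).cexp.fun_mul
    (continuous_kummerM (1 / 2 + μ - κ) (1 + 2 * μ))).tendsto 0).mono_left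
    (nhdsWithin_le_nhds (s := ({0}ᶜ : Set ℂ)))
  simp only [neg_zero, zero_div, exp_zero, kummerM_zero, mul_one] at hcont
  refine hcont.congr' ?_
  filter_upwards [self_mem_nhdsWithin] with z hz
  exact (cpow_neg_mul_whittakerM κ μ hz).symm

/-- **Leading behaviour of `M_{κ,μ}` at `0⁺` along the positive reals**:
`x^{−(½+μ)} M_{κ,μ}(x) → 1` as `x → 0⁺`. [cite: DLMF, 13.14.14] -/
theorem tendsto_cpow_neg_mul_whittakerM_ofReal :
    Tendsto (fun x : ℝ => (x : ℂ) ^ (-(1 / 2 + μ) : ℂ) * whittakerM κ μ x) (𝓝[>] 0) (𝓝 1) := by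
  have hof : Tendsto (fun x : ℝ => (x : ℂ)) (𝓝[>] 0) (𝓝[≠] 0) := by
    refine tendsto_nhdsWithin_of_tendsto_nhds_of_eventually_within _
      ((continuous_ofReal.tendsto' 0 0 ofReal_zero).mono_left nhdsWithin_le_nhds) ?_
    filter_upwards [self_mem_nhdsWithin] with x hx
    exact ofReal_ne_zero.2 (ne_of_gt hx)
  exact (tendsto_cpow_neg_mul_whittakerM κ μ).comp hof

/-! ### The pair `M_{κ,±μ}` -/

/-- **The Frobenius pair at `0`.** For `2μ ∉ ℤ` (precisely: `1 + 2μ` and `1 − 2μ` are not in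
`−ℕ₀`... stated as `1 ± 2μ ≠ −n` for all `n : ℕ`) both `M_{κ,μ}` and `M_{κ,−μ}` solve Whittaker's
equation `W'' = (¼ − κ/z − (¼ − μ²)/z²) W` on the slit plane (leading behaviours `z^{½±μ}`,
`tendsto_cpow_neg_mul_whittakerM`). [cite: DLMF, 13.14.1] -/
theorem whittakerM_pair_ode_hasDerivAt (hμ : ∀ n : ℕ, 1 + 2 * μ ≠ -n)
    (hμ' : ∀ n : ℕ, 1 - 2 * μ ≠ -n) {z : ℂ} (hz : z ∈ slitPlane) :
    (HasDerivAt (whittakerM κ μ) (deriv (whittakerM κ μ) z) z ∧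
      HasDerivAt (deriv (whittakerM κ μ))
        ((1 / 4 - κ / z - (1 / 4 - μ ^ 2) / z ^ 2) * whittakerM κ μ z) z) ∧
    (HasDerivAt (whittakerM κ (-μ)) (deriv (whittakerM κ (-μ)) z) z ∧
      HasDerivAt (deriv (whittakerM κ (-μ)))
        ((1 / 4 - κ / z - (1 / 4 - μ ^ 2) / z ^ 2) * whittakerM κ (-μ) z) z) := by
  refine ⟨whittakerM_ode_hasDerivAt κ μ hμ hz, ?_⟩
  have h := whittakerM_ode_hasDerivAt κ (-μ)
    (fun n => by rw [mul_neg, ← sub_eq_add_neg]; exact hμ' n) hz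
  rwa [neg_sq] at h

/-- Non-resonance in the T1w instance `μ = iδ`, `δ ≠ 0`: `1 ± 2iδ ∉ −ℕ₀`. [folklore] -/
theorem T1w_nonresonant {δ : ℝ} (hδ : δ ≠ 0) :
    (∀ n : ℕ, 1 + 2 * (I * δ) ≠ -n) ∧ (∀ n : ℕ, 1 - 2 * (I * δ) ≠ -n) := by
  refine ⟨fun n h => ?_, fun n h => ?_⟩
  all_goals
    have := congrArg Complex.im h
    simp at this
    exact hδ (by linarith)

/-- **The T1w instance** (extremal Kerr threshold, far face: `κ = im`, `μ = iδ`, `δ ≠ 0`, so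
`2μ = 2iδ ∉ ℤ`): both `M_{im,±iδ}` solve Whittaker's equation on the slit plane.
[cite: DLMF, 13.14.1] -/
theorem whittakerM_pair_T1w (m δ : ℝ) (hδ : δ ≠ 0) {z : ℂ} (hz : z ∈ slitPlane) :
    (HasDerivAt (whittakerM (I * m) (I * δ)) (deriv (whittakerM (I * m) (I * δ)) z) z ∧
      HasDerivAt (deriv (whittakerM (I * m) (I * δ)))
        ((1 / 4 - I * m / z - (1 / 4 - (I * δ) ^ 2) / z ^ 2) * whittakerM (I * m) (I * δ) z) z) ∧
    (HasDerivAt (whittakerM (I * m) (-(I * δ))) (deriv (whittakerM (I * m) (-(I * δ))) z) z ∧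
      HasDerivAt (deriv (whittakerM (I * m) (-(I * δ))))
        ((1 / 4 - I * m / z - (1 / 4 - (I * δ) ^ 2) / z ^ 2) *
          whittakerM (I * m) (-(I * δ)) z) z) :=
  whittakerM_pair_ode_hasDerivAt _ _ (T1w_nonresonant hδ).1 (T1w_nonresonant hδ).2 hz

end WhittakerM

/-! ### The Wronskian of the pair `M_{κ,±μ}` (DLMF §13.14(vii)) -/

section Wronskian

variable (κ μ : ℂ)

/-- **Abel's identity for the pair.** Whittaker's equation has no first-derivative term, so along
the two solutions `M_{κ,±μ}` (`1 ± 2μ ∉ −ℕ₀`) the Wronskian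
`M_{κ,μ} · (M_{κ,−μ})' − (M_{κ,μ})' · M_{κ,−μ}` has derivative `0` on the slit plane. [folklore] -/
theorem hasDerivAt_wronskian_whittakerM (hμ : ∀ n : ℕ, 1 + 2 * μ ≠ -n)
    (hμ' : ∀ n : ℕ, 1 - 2 * μ ≠ -n) {z : ℂ} (hz : z ∈ slitPlane) :
    HasDerivAt (fun w => whittakerM κ μ w * deriv (whittakerM κ (-μ)) w -
      deriv (whittakerM κ μ) w * whittakerM κ (-μ) w) 0 z := by
  obtain ⟨⟨h₁, h₁'⟩, ⟨h₂, h₂'⟩⟩ := whittakerM_pair_ode_hasDerivAt κ μ hμ hμ' hz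
  exact ((h₁.mul h₂').sub (h₁'.mul h₂)).congr_deriv (by ring)

/-- **The Wronskian of `M_{κ,±μ}` is constant on the slit plane** (`1 ± 2μ ∉ −ℕ₀`). [folklore] -/
theorem wronskian_whittakerM_eq (hμ : ∀ n : ℕ, 1 + 2 * μ ≠ -n)
    (hμ' : ∀ n : ℕ, 1 - 2 * μ ≠ -n) {z w : ℂ} (hz : z ∈ slitPlane) (hw : w ∈ slitPlane) :
    whittakerM κ μ z * deriv (whittakerM κ (-μ)) z -
        deriv (whittakerM κ μ) z * whittakerM κ (-μ) z =
      whittakerM κ μ w * deriv (whittakerM κ (-μ)) w -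
        deriv (whittakerM κ μ) w * whittakerM κ (-μ) w := by
  have hpre : IsPreconnected slitPlane :=
    (starConvex_one_slitPlane.isPathConnected one_mem_slitPlane).isConnected.isPreconnected
  exact isOpen_slitPlane.is_const_of_deriv_eq_zero hpre
    (fun x hx =>
      (hasDerivAt_wronskian_whittakerM κ μ hμ hμ' hx).differentiableAt.differentiableWithinAt)
    (fun x hx => (hasDerivAt_wronskian_whittakerM κ μ hμ hμ' hx).deriv) hz hw

/-- The Wronskian of `M_{κ,±μ}` in terms of the regular parts
`F_± = e^{−z/2} M(½ ± μ − κ, 1 ± 2μ, z)` and their derivatives `F_±'`: the Frobenius powers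
`z^{½±μ}` multiply out to `z⁰ = 1` and `z¹`, leaving the ENTIRE expression
`−2μ F₊F₋ + z (F₊F₋' − F₊'F₋)` (pure calculus, no equation used). [folklore] -/
theorem wronskian_whittakerM_eq_regular {z : ℂ} (hz : z ∈ slitPlane) :
    whittakerM κ μ z * deriv (whittakerM κ (-μ)) z -
        deriv (whittakerM κ μ) z * whittakerM κ (-μ) z =
      -2 * μ * ((exp (-z / 2) * kummerM (1 / 2 + μ - κ) (1 + 2 * μ) z) *
          (exp (-z / 2) * kummerM (1 / 2 + -μ - κ) (1 + 2 * -μ) z)) +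
        z * ((exp (-z / 2) * kummerM (1 / 2 + μ - κ) (1 + 2 * μ) z) *
            (exp (-z / 2) * ((1 / 2 + -μ - κ) / (1 + 2 * -μ) *
                kummerM (1 / 2 + -μ - κ + 1) (1 + 2 * -μ + 1) z -
              kummerM (1 / 2 + -μ - κ) (1 + 2 * -μ) z / 2)) -
          (exp (-z / 2) * ((1 / 2 + μ - κ) / (1 + 2 * μ) *
                kummerM (1 / 2 + μ - κ + 1) (1 + 2 * μ + 1) z -
              kummerM (1 / 2 + μ - κ) (1 + 2 * μ) z / 2)) *
            (exp (-z / 2) * kummerM (1 / 2 + -μ - κ) (1 + 2 * -μ) z)) := by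
  have hz0 : z ≠ 0 := slitPlane_ne_zero hz
  rw [(hasDerivAt_whittakerM κ μ hz).deriv, (hasDerivAt_whittakerM κ (-μ) hz).deriv,
    whittakerM_eq_cpow_mul κ μ, whittakerM_eq_cpow_mul κ (-μ)]
  have e1 : z ^ (1 / 2 + μ : ℂ) * z ^ (-μ - 1 / 2 : ℂ) = 1 := by
    rw [← cpow_add _ _ hz0, show (1 / 2 + μ + (-μ - 1 / 2) : ℂ) = 0 by ring, cpow_zero]
  have e2 : z ^ (1 / 2 + μ : ℂ) * z ^ (1 / 2 + -μ : ℂ) = z := by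
    rw [← cpow_add _ _ hz0, show (1 / 2 + μ + (1 / 2 + -μ) : ℂ) = 1 by ring, cpow_one]
  have e3 : z ^ (μ - 1 / 2 : ℂ) * z ^ (1 / 2 + -μ : ℂ) = 1 := by
    rw [← cpow_add _ _ hz0, show (μ - 1 / 2 + (1 / 2 + -μ) : ℂ) = 0 by ring, cpow_zero]
  set P := z ^ (1 / 2 + μ : ℂ)
  set Q := z ^ (1 / 2 + -μ : ℂ)
  set P' := z ^ (μ - 1 / 2 : ℂ)
  set Q' := z ^ (-μ - 1 / 2 : ℂ)
  set F := exp (-z / 2) * kummerM (1 / 2 + μ - κ) (1 + 2 * μ) z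
  set G := exp (-z / 2) * kummerM (1 / 2 + -μ - κ) (1 + 2 * -μ) z
  set F₁ := exp (-z / 2) * ((1 / 2 + μ - κ) / (1 + 2 * μ) *
    kummerM (1 / 2 + μ - κ + 1) (1 + 2 * μ + 1) z - kummerM (1 / 2 + μ - κ) (1 + 2 * μ) z / 2)
  set G₁ := exp (-z / 2) * ((1 / 2 + -μ - κ) / (1 + 2 * -μ) *
    kummerM (1 / 2 + -μ - κ + 1) (1 + 2 * -μ + 1) z - kummerM (1 / 2 + -μ - κ) (1 + 2 * -μ) z / 2)
  linear_combination ((1 / 2 + -μ) * F * G) * e1 + (F * G₁ - F₁ * G) * e2 -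
    ((1 / 2 + μ) * F * G) * e3

/-- **The Wronskian of the Frobenius pair: `𝒲{M_{κ,μ}, M_{κ,−μ}} = −2μ`** on the slit plane, for
`1 ± 2μ ∉ −ℕ₀` (in particular for `2μ ∉ ℤ`). Constancy is Abel's identity
(`wronskian_whittakerM_eq`); the value is read off at `z → 0⁺` from the entire expression
`wronskian_whittakerM_eq_regular`, whose value at `0` is `−2μ · M(·,·,0)² = −2μ`
(Beals–Wong (8.7.4)). [cite: DLMF, 13.14.25] -/
theorem wronskian_whittakerM (hμ : ∀ n : ℕ, 1 + 2 * μ ≠ -n) (hμ' : ∀ n : ℕ, 1 - 2 * μ ≠ -n)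
    {z : ℂ} (hz : z ∈ slitPlane) :
    whittakerM κ μ z * deriv (whittakerM κ (-μ)) z -
        deriv (whittakerM κ μ) z * whittakerM κ (-μ) z = -2 * μ := by
  -- the entire right-hand side of `wronskian_whittakerM_eq_regular`, as a function of `z`
  set a : ℂ := 1 / 2 + μ - κ with ha
  set b : ℂ := 1 + 2 * μ with hb
  set a' : ℂ := 1 / 2 + -μ - κ with ha'
  set b' : ℂ := 1 + 2 * -μ with hb'
  set R : ℂ → ℂ := fun w =>
    -2 * μ * ((exp (-w / 2) * kummerM a b w) * (exp (-w / 2) * kummerM a' b' w)) +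
      w * ((exp (-w / 2) * kummerM a b w) *
          (exp (-w / 2) * (a' / b' * kummerM (a' + 1) (b' + 1) w - kummerM a' b' w / 2)) -
        (exp (-w / 2) * (a / b * kummerM (a + 1) (b + 1) w - kummerM a b w / 2)) *
          (exp (-w / 2) * kummerM a' b' w)) with hR
  have hRc : Continuous R := by
    have hk : ∀ p q : ℂ, Continuous fun w : ℂ => kummerM p q w := fun p q => continuous_kummerM p q
    have he : Continuous fun w : ℂ => exp (-w / 2) := (continuous_neg.div_const 2).cexp
    simp only [hR]
    fun_prop
  have hR0 : R 0 = -2 * μ := by simp [hR]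
  -- the Wronskian is the constant `K := its value at 1`, and equals `R` on the slit plane
  set K := whittakerM κ μ 1 * deriv (whittakerM κ (-μ)) 1 -
    deriv (whittakerM κ μ) 1 * whittakerM κ (-μ) 1 with hK
  have hconst : ∀ x : ℝ, 0 < x → R x = K := fun x hx => by
    rw [hK, ← wronskian_whittakerM_eq κ μ hμ hμ' (ofReal_mem_slitPlane.2 hx) one_mem_slitPlane,
      wronskian_whittakerM_eq_regular κ μ (ofReal_mem_slitPlane.2 hx)]
  -- let `x → 0⁺`
  have hlim : Tendsto (fun x : ℝ => R x) (𝓝[>] 0) (𝓝 (R 0)) :=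
    ((hRc.comp continuous_ofReal).tendsto' 0 (R 0) (by simp)).mono_left nhdsWithin_le_nhds
  have hlim' : Tendsto (fun x : ℝ => R x) (𝓝[>] 0) (𝓝 K) := tendsto_const_nhds.congr'
    (by filter_upwards [self_mem_nhdsWithin] with x hx using (hconst x hx).symm)
  rw [wronskian_whittakerM_eq κ μ hμ hμ' hz one_mem_slitPlane, ← hK,
    tendsto_nhds_unique hlim' hlim, hR0]

/-- **The T1w instance of the Wronskian** (`κ = im`, `μ = iδ`, `δ ≠ 0`):
`𝒲{M_{im,iδ}, M_{im,−iδ}}(z) = −2iδ` on the slit plane. [cite: DLMF, 13.14.25] -/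
theorem wronskian_whittakerM_T1w (m δ : ℝ) (hδ : δ ≠ 0) {z : ℂ} (hz : z ∈ slitPlane) :
    whittakerM (I * m) (I * δ) z * deriv (whittakerM (I * m) (-(I * δ))) z -
        deriv (whittakerM (I * m) (I * δ)) z * whittakerM (I * m) (-(I * δ)) z =
      -2 * (I * δ) :=
  wronskian_whittakerM _ _ (T1w_nonresonant hδ).1 (T1w_nonresonant hδ).2 hz

end Wronskian

end Literature.Analysis.SpecialFunctions.Confluent

end
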